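/-
Copyright (c) 2026 the pub-hodgecm-mathlib formalisation cell (harness21).  Prover seat hodgecm-mathlib-F0P2-p01 (g26): E1 row 60 = 47d-6b-A «PER-TYPE WRAPPER: `hm_q` FROM ★ (α)
MACKEY + ★ (G4) LOCAL MODEL, TERMWISE» (E1 keeper ∕ dealer F0P3a-p03 (g30) 03:24:53Z; link letters listed by the 47d pen F0P3a-p04 (g31) 03:23:15Z), 2026-09-03.
-/
import Literature.NumberTheory.Automorphic.SchneiderStuhlerEPInducedTraceMackey   -- ★ 47d (α): `finrank_intertwiningMap_smoothIndRep_eq_sum_finrank_eigen`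
import Literature.RepresentationTheory.CoinvariantsBlockLocalModel              -- ★ 47d (G4): `finrank_eigen_localModel_eq`
import HarnessLib

/-!
# The per-type multiplicity of an induced representation as a sum of Jacquet–eigen block terms (the wrapper `hm_q` of the non-elliptic vanishing)

Topic `NumberTheory/Automorphic`; namespace `Representation`; THEOREMS ONLY (no definition, instance, notation or named fact).  Cell `pub/hodgecm-mathlib` (D-0151), crux H413 =
`stmt-HodgeConjecture-24833`, lane `--supports`; E1 row 60 (= 47d FILE 6b-A).  Count-neutral generic base layer; HC_CM is proved only modulo the 7 printed citations (2 remaining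
named inputs: hLiu418 = `stmt-HodgeConjecture-24832`, h413 = `stmt-HodgeConjecture-24833`) until rung 0 closes.

THE WRAPPER.  ★ 47d HEAD v2 `smoothTrace_epFunction_sub_eq_zero_of_blockSums` wants, for every simplex type `i`, the hypothesis
`hm_q i : dim Hom_{P_i}(E_i, π′|_{P_i}) = Σ_j e_q (r i j)` with `e_q b = dim ([W_b] ⊓ E_q)` the Jacquet–eigen block term of ★ 5b `sum_finrank_block_eigen_eq_of_tree`.  For
`π′ = (Ind_H^Γ σ)|_K` (`K = P_i`, `E = E_i = V^{U_i}`, `σ` a character of `H = B` on a line `W`) this file produces `hm_q i` by composing, Mackey representative by Mackey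
representative `g_j`:
* ★ (α) `finrank_intertwiningMap_smoothIndRep_eq_sum_finrank_eigen`: `dim Hom_K(E, Ind σ|_K) = Σ_j dim ↥(Eig j)` (`Eig j` = the `χ_j`-eigenspace of the compact torus `C_j ≤ T_j =
  H ∩ g_j K g_j⁻¹` on the local Jacquet module `Q_j` of `E′_j = ρ(g_j) E`), and
* ★ (G4) `finrank_eigen_localModel_eq`: `dim ↥(Eig j) = dim ([W_{r j}] ⊓ E_N)` once `E′_j` is embedded as the block `W_{r j}` of the block-permutation module `M` (the `q`-chains
  restricted to the unipotent radical `N`, ★ 47c FILE 1∕2a letters `Blk act R rep tr`) — through the LINK LETTERS of the representative `j`: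
  (L1) a homomorphism `φN j : N_{r j} → T_j` from the stabiliser of the block in `N` ONTO the subgroup `N_j ≤ T_j` (`hφN`, `hφNsurj`) under which `emb j` is equivariant (`hembN`)
  — at the Bruhat–Tits datum `N_{r} = N ∩ P_r = T_j ∩ N`, both acting through `ρ`;
  (L2) a global index `ιC` of the compact torus with surjections `cj j : ιC ↠ C_j`, its action `TM` on `M` (`hembT`) and `Tc` on the Jacquet module `M_N` (`hmkT`), the values
  `χ′` of the character (`hχ′ : χ_j ∘ cj j = χ′`) and the global eigenspace `E_N` (`hEN`) — at the datum `ιC = T_c`, `Tc c = jacquetModule c`.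
* §1 `coinvariantsKer_comp_eq_of_forall_exists`: the coinvariant kernel of a restricted representation only depends on the IMAGE of the restricting homomorphism (so (α)'s
  `ker q_j = ker_{N_j}` is (G4)'s `ker q_j = ker_{N_{r j}}` along (L1)); `mem_eigen_iff_of_surjective`: (α)'s `hEig` over `C_j` is (G4)'s `hEig` over `ιC` along (L2).
* §2 **`finrank_intertwiningMap_smoothIndRep_eq_sum_finrank_block_eigen`** — THE PER-TYPE WRAPPER
  `finrank k (IntertwiningMap τ ((smoothIndRep H σ).comp K.subtype)) = ∑ j, finrank k ↥((Blk (r j)).map (Coinvariants.mk τM) ⊓ E_N)` = `hm_q` of ★ HEAD v2 with `κ_q i = ι`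
  (the Mackey representatives of type `i`), `r_q i = r`, `e_q = fun b => finrank ↥((Blk b).map mk ⊓ E_N)` (★ 5b's currency).
Everything local is hypothesis-style exactly as in ★ (α) and ★ (G4); the datum (row 61 ∕ 47e) supplies `φN j` and `cj j` by `Subgroup.inclusion`-type maps.

## References
* [SchneiderStuhler1997] P. Schneider, U. Stuhler, *Representation theory and sheaves on the Bruhat–Tits building*, Publ. Math. IHÉS 85 (1997), §III.4 (Lemma III.4.13, Lemma III.4.18).
* [BernsteinZelevinsky1977] I. N. Bernstein, A. V. Zelevinsky, *Induced representations of reductive 𝔭-adic groups I*, Ann. Sci. ÉNS 10 (1977), §2.3, Thm 5.2.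
* [Casselman1995] W. Casselman, *Introduction to the theory of admissible representations of `p`-adic reductive groups* (1995 notes), §3.2, §6.3.
-/

set_option autoImplicit false

namespace Representation

open Function Module

/-! ## §1 Two reindexing lemmas -/

section Reindex

variable {k G V : Type*} [CommRing k] [Group G] [AddCommGroup V] [Module k V]

/-- The coinvariant kernel of a restriction `ρ ∘ f` only depends on the image of `f`: if `f : S →* G` and `g : S′ →* G` have the same image then
`Coinvariants.ker (ρ.comp f) = Coinvariants.ker (ρ.comp g)`. [cite: Casselman1995, §3.2] -/
theorem coinvariantsKer_comp_eq_of_forall_exists {S S' : Type*} [Group S] [Group S'] (ρ : Representation k G V) (f : S →* G) (g : S' →* G)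
    (hfg : ∀ s : S, ∃ s' : S', g s' = f s) (hgf : ∀ s' : S', ∃ s : S, f s = g s') :
    Coinvariants.ker (ρ.comp f) = Coinvariants.ker (ρ.comp g) := by
  apply le_antisymm
  · refine Submodule.span_le.2 ?_
    rintro _ ⟨⟨s, v⟩, rfl⟩
    obtain ⟨s', hs'⟩ := hfg s
    exact Coinvariants.mem_ker_of_eq s' v _ (by simp only [MonoidHom.comp_apply, hs'])
  · refine Submodule.span_le.2 ?_
    rintro _ ⟨⟨s', v⟩, rfl⟩
    obtain ⟨s, hs⟩ := hgf s'
    exact Coinvariants.mem_ker_of_eq s v _ (by simp only [MonoidHom.comp_apply, hs])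

/-- A simultaneous eigenspace described over a group `C` is described over any index set mapping ONTO `C`. [cite: Casselman1995, §3.2] -/
theorem mem_eigen_iff_of_surjective {C Q : Type*} [Group C] [AddCommGroup Q] [Module k Q] (σQ : Representation k C Q) (χ : C →* kˣ)
    {Eig : Submodule k Q} (hEig : ∀ v, v ∈ Eig ↔ ∀ c : C, σQ c v = ((χ c : kˣ) : k) • v)
    {ιC : Type*} (cj : ιC → C) (hcj : Surjective cj) (χ' : ιC → k) (hχ' : ∀ i, ((χ (cj i) : kˣ) : k) = χ' i) (v : Q) :
    v ∈ Eig ↔ ∀ i : ιC, (σQ (cj i) : Q →ₗ[k] Q) v = χ' i • v := by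
  rw [hEig]
  constructor
  · intro h i
    rw [← hχ' i]
    exact h (cj i)
  · intro h c
    obtain ⟨i, rfl⟩ := hcj c
    rw [hχ' i]
    exact h i

end Reindex

/-! ## §2 The per-type wrapper -/

section PerType

variable {k Γ V W : Type*} [Field k] [CharZero k] [Group Γ] [TopologicalSpace Γ] [IsTopologicalGroup Γ] [AddCommGroup V] [Module k V] [AddCommGroup W] [Module k W]
  (ρ : Representation k Γ V) {H K : Subgroup Γ} (σ : Representation k H W) {E : Submodule k V} (τ : Representation k K E)
  (hτE : ∀ (κ : K) (e : E), ((τ κ e : E) : V) = ρ (κ : Γ) e)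

include hτE in
/-- **THE PER-TYPE WRAPPER `hm_q`: `dim Hom_K(E, (Ind_H^Γ σ)|_K) = Σ_j dim ([W_{r j}] ⊓ E_N)`** — ★ (α) `finrank_intertwiningMap_smoothIndRep_eq_sum_finrank_eigen` (its hypotheses
verbatim: the Mackey data `hKo hτsm hcover hdisj σc hσc` and, for each representative `j`, the local data `T E′ τ′ σT C N hdec hWN Q q hq hker σQ hσQ hC χ hχ σtw hsm htw Eig hEig`,
`hW1`) docked TERMWISE onto ★ (G4) `finrank_eigen_localModel_eq` (its block-permutation data `τM Blk act hint hact hact1 hperm R rep tr htr hrep_act hrep_id`, and for each `j` the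
block `r j ∈ R`, the local model `emb j` with `range = Blk (r j)` and the stabiliser `Nr j` of `r j` in `N`) through the link letters (L1) `φN hφN hφNsurj hembN` and (L2)
`cj hcj TM hembT Tc hmkT χ′ hχ′ hEN`.  The right-hand side is ★ 5b's `e_q` summed over the representatives of type `i`, i.e. `hm_q i` of ★ 47d HEAD v2.
[cite: SchneiderStuhler1997, §III.4 Lemma III.4.13, Lemma III.4.18] [cite: BernsteinZelevinsky1977, §2.3, Thm 5.2] [cite: Casselman1995, §6.3] -/
theorem finrank_intertwiningMap_smoothIndRep_eq_sum_finrank_block_eigen [FiniteDimensional k E] {ι : Type*} [Fintype ι] {g : ι → Γ}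
    (hKo : IsOpen (K : Set Γ)) (hτsm : τ.IsSmooth)
    (hcover : ∀ y : Γ, ∃ i, ∃ h : H, ∃ κ ∈ K, y = h * g i * κ)
    (hdisj : ∀ i j, (∃ h : H, ∃ κ ∈ K, g j = h * g i * κ) → i = j)
    (σc : ∀ i, Representation k ↥((H.map (MulAut.conj (g i)⁻¹).toMonoidHom).subgroupOf K) W)
    (hσc : ∀ (i : ι) (s : ↥((H.map (MulAut.conj (g i)⁻¹).toMonoidHom).subgroupOf K)),
      σc i s = σ ⟨g i * ((s : K) : Γ) * (g i)⁻¹, (mem_subgroupOf_map_conj_inv_iff H K (g i) s).1 s.2⟩)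
    (T : ι → Subgroup Γ) (hT : ∀ (i : ι) (y : Γ), y ∈ T i ↔ y ∈ H ∧ (g i)⁻¹ * y * g i ∈ K)
    (E' : ι → Submodule k V) (hE : ∀ i, E.map (ρ (g i)) = E' i)
    (τ' : ∀ i, Representation k (T i) (E' i)) (hτ' : ∀ (i : ι) (t : T i) (e : E' i), ((τ' i t e : E' i) : V) = ρ (t : Γ) e)
    (σT : ∀ i, Representation k (T i) W) (hσT : ∀ (i : ι) (t : T i) (h : H), (h : Γ) = (t : Γ) → σT i t = σ h)
    (C N : ∀ i, Subgroup (T i)) (hdec : ∀ (i : ι) (t : T i), ∃ c ∈ C i, ∃ n ∈ N i, t = c * n) (hWN : ∀ i, ∀ n ∈ N i, σT i n = 1)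
    {Q : ι → Type*} [∀ i, AddCommGroup (Q i)] [∀ i, Module k (Q i)] [∀ i, FiniteDimensional k (Q i)]
    (q : ∀ i, E' i →ₗ[k] Q i) (hq : ∀ i, Surjective (q i)) (hker : ∀ i, LinearMap.ker (q i) = Coinvariants.ker ((τ' i).comp (N i).subtype))
    (σQ : ∀ i, Representation k (C i) (Q i)) (hσQ : ∀ (i : ι) (c : C i) (e : E' i), q i (τ' i (c : T i) e) = σQ i c (q i e))
    (hC : ∀ i, IsCompact (C i : Set (T i))) (χ : ∀ i, C i →* kˣ) (hχ : ∀ (i : ι) (c : C i) (w : W), σT i (c : T i) w = ((χ i c : kˣ) : k) • w)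
    (σtw : ∀ i, Representation k (T i) (Q i)) (hsm : ∀ i, (σtw i).IsSmooth)
    (htw : ∀ (i : ι) (c : C i) (v : Q i), σtw i (c : T i) v = ((χ i c : kˣ) : k)⁻¹ • σQ i c v)
    (Eig : ∀ i, Submodule k (Q i)) (hEig : ∀ (i : ι) (v : Q i), v ∈ Eig i ↔ ∀ c : C i, σQ i c v = ((χ i c : kˣ) : k) • v)
    (hW1 : finrank k W = 1)
    -- ★ (G4) globals: the block-permutation module `M` of the unipotent radical (type `Nty`) and its representatives
    {Nty M : Type*} [Group Nty] [AddCommGroup M] [Module k M] (τM : Representation k Nty M)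
    {β : Type*} [DecidableEq β] (Blk : β → Submodule k M) (act : Nty → β → β)
    (hint : DirectSum.IsInternal Blk) (hact : ∀ n n' b, act (n * n') b = act n (act n' b)) (hact1 : ∀ b, act 1 b = b)
    (hperm : ∀ n b m, m ∈ Blk b → τM n m ∈ Blk (act n b))
    {R : Set β} (rep : β → β) (tr : β → Nty) (htr : ∀ b, act (tr b) (rep b) = b) (hrep_act : ∀ n b, rep (act n b) = rep b) (hrep_id : ∀ b ∈ R, rep b = b)
    -- per representative: the block, the local model, the stabiliser in `N`, and the link letters (L1)
    (r : ι → β) (hr : ∀ j, r j ∈ R)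
    (emb : ∀ j, E' j →ₗ[k] M) (hinj : ∀ j, Injective (emb j)) (hrange : ∀ j, LinearMap.range (emb j) = Blk (r j))
    (Nr : ι → Subgroup Nty) (hNr : ∀ (j : ι) (s : Nty), s ∈ Nr j ↔ act s (r j) = r j)
    (φN : ∀ j, ↥(Nr j) →* ↥(T j)) (hφN : ∀ (j : ι) (s : Nr j), φN j s ∈ N j) (hφNsurj : ∀ (j : ι) (n : N j), ∃ s : Nr j, φN j s = (n : T j))
    (hembN : ∀ (j : ι) (s : Nr j) (e : E' j), emb j (τ' j (φN j s) e) = τM (s : Nty) (emb j e))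
    -- the compact torus (L2): global index, local surjections, its actions on `M` and on the Jacquet module `M_N`, the global eigenspace
    {ιC : Type*} (cj : ∀ j, ιC → ↥(C j)) (hcj : ∀ j, Surjective (cj j))
    (TM : ιC → M →ₗ[k] M) (hembT : ∀ (j : ι) (i : ιC) (e : E' j), emb j (τ' j ((cj j i : C j) : T j) e) = TM i (emb j e))
    (Tc : ιC → Coinvariants τM →ₗ[k] Coinvariants τM) (hmkT : ∀ (i : ιC) (m : M), Coinvariants.mk τM (TM i m) = Tc i (Coinvariants.mk τM m))
    (χ' : ιC → k) (hχ' : ∀ (j : ι) (i : ιC), ((χ j (cj j i) : kˣ) : k) = χ' i)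
    {EN : Submodule k (Coinvariants τM)} (hEN : ∀ x, x ∈ EN ↔ ∀ i : ιC, Tc i x = χ' i • x) :
    finrank k (IntertwiningMap τ ((smoothIndRep H σ).comp K.subtype)) = ∑ j, finrank k ↥((Blk (r j)).map (Coinvariants.mk τM) ⊓ EN) := by
  rw [finrank_intertwiningMap_smoothIndRep_eq_sum_finrank_eigen ρ σ τ hτE hKo hτsm hcover hdisj σc hσc T hT E' hE τ' hτ' σT hσT C N hdec hWN
    q hq hker σQ hσQ hC χ hχ σtw hsm htw Eig hEig hW1]
  refine Finset.sum_congr rfl fun j _ => ?_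
  -- (L1): the coinvariant kernel of `Q j` read over the stabiliser `Nr j` of the block
  have hker' : LinearMap.ker (q j) = Coinvariants.ker ((τ' j).comp (φN j)) := by
    rw [hker j]
    exact coinvariantsKer_comp_eq_of_forall_exists (τ' j) (N j).subtype (φN j)
      (fun n => hφNsurj j n) (fun s => ⟨⟨φN j s, hφN j s⟩, rfl⟩)
  -- (L2): the eigenspace over the global torus index
  have hEig' : ∀ v : Q j, v ∈ Eig j ↔ ∀ i : ιC, (σQ j (cj j i) : Q j →ₗ[k] Q j) v = χ' i • v :=
    mem_eigen_iff_of_surjective (σQ j) (χ j) (hEig j) (cj j) (hcj j) χ' (hχ' j)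
  exact finrank_eigen_localModel_eq (τ := τM) (Blk := Blk) (act := act) hint hact hact1 hperm rep tr htr hrep_act hrep_id (hr j)
    (emb j) (hinj j) (hrange j) (Nr j) (hNr j) ((τ' j).comp (φN j)) (fun s e => hembN j s e) (q j) (hq j) hker'
    (TE := fun i => (τ' j ((cj j i : C j) : T j) : E' j →ₗ[k] E' j)) (TQ := fun i => (σQ j (cj j i) : Q j →ₗ[k] Q j)) (TM := TM) (T := Tc)
    (fun i e => hσQ j (cj j i) e) (fun i e => hembT j i e) hmkT (χ := χ') hEig' hEN

end PerType

end Representation
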